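import Literature.MathematicalPhysics.QuantumFieldTheory.Balaban1983to89.T4InputCauchyRateData

/-!
# OutputRateFunctionalTables — FUNCTION TABLES on the EXISTING step model: the background adjoined to the domain index
# (NE5 crux O1, owner RULING R48 ∕ design item R48-F realised on the kernel-free road of `B13HistInsertion`'s modelling note;
# cell `pub-balaban`, T⁴ fan-out, `HOME/CLAIMS.log` l.15388 (R48), l.15426 (substrate-typer ACK), INTENT l.15569)

Unit `b2b-balaban-t4-ne5-formalise-leaf-02` (NE5 formalisation swarm, leaf prover 02, gen 16).  Summits-side NEW WORK under the
LEAN PLACEMENT RULE (cell modelling + bookkeeping over ABSTRACT carriers; NOT a Literature module; nothing printed is asserted,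
no `[cite:]` tag, no `Prop`-valued fact is minted — trigger `t4/T4-NE5-TRIGGER.json` c3).  HONEST FRAMING: rung (B)+1 of the
FINITE-VOLUME T⁴ continuum programme — NOT infinite volume, NOT a mass gap, NOT the Clay problem, NOT a proof of NE5 (NE5 is
NOT PRINTED: [Balaban1987RG1]–[Balaban1989LargeFieldII] print ε-UNIFORM bounds, never two-spacing RATES; cell GAPS G-t4-U3-1).
HONEST DEPENDENCY (cell line, verbatim): continuum YM on T⁴ ⇐ BetaPertH ∧ nine spine estimates (0/9 proved); BetaPertH ⇐ (D1) ∧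
(D4) ∧ CAP+tail; G-an2-4 gates asym, D1 and NE2/3/4.

THE DEFECT BEING REPAIRED IN TYPE (owner R48, a LOCATED defect of the MODEL OF RECORD at leaf MI-R, class «model poorer than
print»; nothing landed is false).  In the kernel `T4InputCauchyRateData.StepModel C Op Hist` a run's history insertion
`insB g U k : (C.Dom → ℝ) → Hist` receives the VALUE TABLE `tableB EB g U = fun Y => EB g U Y` of the earlier terms at the ONE
real background `U`, whereas in [Balaban1988RG2Cluster] Lemma 1 (1.33) p. 9 ∕ (1.23) p. 7 the earlier terms `𝐄^{(j)}`,
`j ≤ k`, enter the `k+1`-st step through `V′_k(Y, U_{k+1}, B′) = Σ [𝐄^{(j)}(X, U_j(·exp iB′·)) − 𝐄^{(j)}(X, U_j(·))]` — as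
FUNCTIONS of the background ([Balaban1987RG1] (1.18) p. 263: *"defined and analytic on the space 𝐔^c_j"*).  The header of
leaf-06's `B13HistInsertion` (p207922, MODELLING NOTE) records the two roads: either the table codomain becomes a space of
functions of the background (owner R48-F's typed shape: `InsDatum` polymorphic in a normed table codomain `F`), or *"the
carriers' `Dom` indexes the background argument as well"*.  THIS MODULE TYPES THE SECOND ROAD, which re-types and re-proves
NOTHING OF THE KERNEL: the kernel (C0 `T4InputCauchyRate.ne5_of_recursiveRate`, C1 `StepModel.ne5_of_stepModel…`), leaf-06's
`InsDatum` ∕ `…Loc` and every GEOMETRY-FREE END face are polymorphic in `C : Carriers` and apply VERBATIM over the re-indexed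
carriers.  CAVEAT (leaf-01 lineage F-ne5leaf01g13-1, kernel-checked: `IsEmpty (DomainGeometry (paramCarriers R.carriers 𝒰) _)`
for an infinite chart — `level k` is a `Finset`; and the END stack OF RECORD is stated on `R.carriers`, not `C`-polymorphic): the
geometry-consuming END monoliths of record are NOT re-indexed; on this road they serve PER BACKGROUND over the record's carriers
and meet the re-indexed model ONLY through pointwise → family junctions (part 2 `outputEnvelope_of_pointwise` etc.; ONE junction
per consumed face, the termwise ones NOT in these modules).  Owner RULING R49 (l.16073): Road D is OF RECORD for R48-F.  The
functional-level shapes (`NE5`, `DecayBound`, `NE9`) transfer back to the ORIGINAL carriers by one-line lemmas.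

WHAT IS TYPED ([folklore] bookkeeping; NO estimate).
* §1 `paramCarriers C 𝒰 : Carriers` for ANY background chart `ρ : 𝒰 → C.BgB` (the chart enters only the lifts): `Dom := C.Dom × 𝒰`,
  `scale`∕`d` read through `.1`, and the model's background slots TRIVIALISED (`BgA = BgB := PUnit`, `transport := id`,
  `gauge := 0`) — the background now lives in the domain index, so a step model over `paramCarriers C 𝒰` carries ONE operator
  datum `opB g () k : Op` per step (for a faithful instance: the background-FAMILY of the step's operators over the chart, with a
  norm uniform in the background — print-compatible, [Balaban1988RG2Cluster] (1.5) p. 3: the bounds on the step's operators are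
  uniform in the background; a design decision of the instancer, NOT made here) and its output `Out k 𝔬 𝔥 (X, u)` is read AT the
  chart point `u` (basic case `𝒰 = C.BgB`, `ρ = id`).
* §2 the lifts `liftB ρ EB g _ (X, u) := EB g (ρ u) X`, `liftA ρ EA g _ (X, u) := EA g (C.transport (ρ u)) X` and the FUNCTION
  TABLES `funTableB ρ EB g Y u := EB g (ρ u) Y`, `funTableA ρ EA g Y u := EA g (C.transport (ρ u)) Y`; `tableB_liftB` ∕
  `tableA_liftA`: the kernel's tables of the lifts ARE the uncurried function tables (by `rfl`) — background-FREE.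
* §3 TRANSFER of the functional-level shapes: `ne5_lift_iff (hρ : Surjective ρ) : NE5 (liftA ρ EA) (liftB ρ EB) W κ θ C₅ ↔
  NE5 EA EB W κ θ C₅` (the END direction `ne5_of_ne5_lift` needs `ρ` onto; the hypothesis direction is unconditional);
  `decayBound_liftB_iff` ∕ `decayBound_liftA_of` ∕ `decayBound_liftA_iff` (L05 ∕ L06 over `C` ⟹ over `paramCarriers`);
  `ne9_liftB_iff`; `ne5_of_section` (NE5 over `C` from ANY pair over `paramCarriers` reading the runs along a
  section of the chart — owner R49 (4)'s Re-row transfer); `lipBackground_liftA` (VACUOUS; U3's bracket stays over the ORIGINAL `C`).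
* §4 over a step model `M : StepModel (paramCarriers C 𝒰) Op Hist`: `representsB_lift_iff` ∕ `representsA_lift_iff` DISPLAY the
  recursion the model then encodes — `EB g (ρ u) X = Re (M.Out k (M.opB g () k) (M.insB g () k (fun (Y, u′) ↦ EB g (ρ u′) Y)) (X, u))`:
  THE STEP READS THE EARLIER TERMS AS FUNCTIONS OF THE BACKGROUND, i.e. leaf MI-R («Bałaban's 𝐄^{(k+1)} IS `Out k` at the two
  runs' data») is instantiable IN TYPE on the existing `StepModel`; `insScaleBoundLevel_param_iff` DISPLAYS the W3 binder over
  `paramCarriers` as R48-F's SUP-OVER-THE-BACKGROUND entry bound (`∀ u, |t (Y, u)| ≤ T·e^{−κ d(Y)}` — the `‖t Y‖_F ≤ …` of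
  R48-F with `F` the sup-normed functions on the chart; the kernel's inherited discrepancies `D_j` are unchanged, being already
  suprema over the background — owner l.15388).
* §5 SPECIMEN END FACES over the original carriers: `ne5_of_stepModel_lift` = the kernel's `StepModel.ne5_of_stepModel` over
  `paramCarriers C 𝒰` followed by §3, and `ne5_of_stepModel_affine_nat_lift` (printed age normalisation, structural binders) —
  conclusion `T4OutputRate.NE5 EA EB W κ θ C₅` LITERALLY; every other GEOMETRY-FREE END face is used the same way (apply it
  over `paramCarriers C 𝒰` to the lifts, then `ne5_of_ne5_lift`); geometry-consuming ones only SPLIT (caveat above).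
* §6 NON-VACUITY: the kernel's toy (`T4InputCauchyRateData.toyModel`, a genuine history feed) re-indexed over
  `paramCarriers toyCarriers Unit` (`toyModelParam`, every slot read through the kernel's) satisfies every binder of §5's first
  face (each by the kernel's own toy lemma, definitionally); `toyParam_ne5` = the kernel's END fired over the re-indexed toy
  carriers, and an `example` recovers the kernel's landed `toy_ne5Data` statement over the ORIGINAL toy carriers through the lift.
WHAT IS NOT HERE (said plainly).  (i) The owner's typed shape ITSELF — `InsDatum (C) (IOp Hist F)` polymorphic in a normed table
codomain with `‖t Y‖` binders and a `toValued`∕`ofValued` pair: on this road it is not needed (leaf-06's `InsDatum` applies verbatim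
to tables on `C.Dom × 𝒰`); if the owner keeps the `F`-road for the record, this module is its `F := (𝒰 → ℝ)` junction and the
owner rules.  (ii) No instance: the substrate's `slotsOfRecord` over `paramCarriers (TwoRuns.carriers …) 𝒰` with family-valued
operator slots is the instancer's (substrate cell ∕ owner), as is the reading of row NE2's tower sockets family-wise; part 2
`OutputRateFunctionalTablesFamily` types the family currency `ℓ^∞(𝒰; Op)` ∕ `ℓ^∞(𝒰; Hist)` and discharges the kernel's W1 ∕ W2 ∕ W3
binders for it from their POINTWISE-in-the-background forms (so the instancer's inputs stay per-background).  (iii) CAVEAT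
(leaf-06, author of `B13HistInsertion`, F2 l.15813): the FINITE-RANK classes `B13HistInsertion.KernelDatum` ∕ `InsertionLinearClass.
LinearInsertion` (`dom k : Finset C.Dom`) do NOT lift faithfully — over `paramCarriers` their `dom k` is a finite set of (domain,
chart point) pairs, i.e. an insertion reading the function table at FINITELY MANY backgrounds, not (1.33)'s; the faithful insertion
datum on this road is the GENERAL `InsDatum.slice k j a : (C.Dom × 𝒰 → ℝ) → Hist` (W3 = the displayed `SliceBudget` in sup-currency, F1,
or the channel road, F3 — there NE9's `Bg`-indexed history families and these `Dom × 𝒰` tables are ONE object under `𝒰 = Bg`).  (iv) No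
estimate of [II]; nothing about Bałaban's functionals is asserted.  0 sorry; axioms ⊆ {propext, Classical.choice, Quot.sound}.
-/

noncomputable section

open scoped BigOperators
open Finset Function

namespace Summit.QuantumFields.BalabanUV.T4Continuum.OutputRateFunctionalTables

open Literature.MathematicalPhysics.QuantumFieldTheory.Balaban1983to89
open Literature.MathematicalPhysics.QuantumFieldTheory.Balaban1983to89.T4OutputRate
open Literature.MathematicalPhysics.QuantumFieldTheory.Balaban1983to89.T4InputCauchyRate (toyCarriers toyEA toyEB)
open Literature.MathematicalPhysics.QuantumFieldTheory.Balaban1983to89.T4InputCauchyRateData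

/-! ## §1 The carriers with a background parameter adjoined to the domain index -/

/-- [folklore] DATA: the carriers `C` RE-INDEXED by a background chart type `𝒰` — a domain is a pair (domain of `C`, chart
point), creation step and tree length are those of the first component, and the model's own background slots are trivial
(`PUnit`, transport `id`, gauge `0`): over these carriers a step model's tables `Dom → ℝ` are tables `C.Dom × 𝒰 → ℝ`, i.e.
FUNCTION tables `C.Dom → (𝒰 → ℝ)` uncurried (the second road of `B13HistInsertion`'s modelling note). -/
abbrev paramCarriers (C : Carriers) (𝒰 : Type) : Carriers where
  Dom := C.Dom × 𝒰
  scale p := C.scale p.1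
  d p := C.d p.1
  d_nonneg p := C.d_nonneg p.1
  BgA := PUnit
  BgB := PUnit
  gauge _ _ := 0
  gauge_nonneg _ _ := le_rfl
  transport := id

variable {C : Carriers} {𝒰 : Type}

/-- [folklore] The creation step of a re-indexed domain is that of its first component. -/
@[simp] theorem paramCarriers_scale (p : C.Dom × 𝒰) : (paramCarriers C 𝒰).scale p = C.scale p.1 := rfl

/-- [folklore] The tree length of a re-indexed domain is that of its first component. -/
@[simp] theorem paramCarriers_d (p : C.Dom × 𝒰) : (paramCarriers C 𝒰).d p = C.d p.1 := rfl

/-- [folklore] The re-indexed carriers' transport is the identity of the trivial background slot. -/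
@[simp] theorem paramCarriers_transport (u : (paramCarriers C 𝒰).BgB) : (paramCarriers C 𝒰).transport u = u := rfl

/-! ## §2 The lifts of the two runs' functionals and their FUNCTION TABLES -/

/-- [folklore] DATA: run B's functional LIFTED to the re-indexed carriers along the chart `ρ` — at the re-indexed domain
`(X, u)` it is run B's term at `X` and at the background `ρ u` (the trivial background slot is not read). -/
def liftB (ρ : 𝒰 → C.BgB) (EB : Functional C C.BgB) : Functional (paramCarriers C 𝒰) (paramCarriers C 𝒰).BgB :=
  fun g _ p => EB g (ρ p.2) p.1

/-- [folklore] DATA: run A's functional LIFTED to the re-indexed carriers along the chart `ρ` — at `(X, u)` it is run A's term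
at `X` and at the TRANSPORTED background `C.transport (ρ u)` (the pairing of the two runs, as in `T4OutputRate.NE5`). -/
def liftA (ρ : 𝒰 → C.BgB) (EA : Functional C C.BgA) : Functional (paramCarriers C 𝒰) (paramCarriers C 𝒰).BgA :=
  fun g _ p => EA g (C.transport (ρ p.2)) p.1

/-- [folklore] DATA: run B's FUNCTION TABLE on the chart — the earlier term at `Y` as a function of the chart point. -/
def funTableB (ρ : 𝒰 → C.BgB) (EB : Functional C C.BgB) (g : ℕ → ℝ) : C.Dom → 𝒰 → ℝ := fun Y u => EB g (ρ u) Y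

/-- [folklore] DATA: run A's FUNCTION TABLE on the chart (at transported backgrounds). -/
def funTableA (ρ : 𝒰 → C.BgB) (EA : Functional C C.BgA) (g : ℕ → ℝ) : C.Dom → 𝒰 → ℝ :=
  fun Y u => EA g (C.transport (ρ u)) Y

/-- [folklore] The lift of run B, evaluated. -/
@[simp] theorem liftB_apply (ρ : 𝒰 → C.BgB) (EB : Functional C C.BgB) (g : ℕ → ℝ) (v : (paramCarriers C 𝒰).BgB)
    (p : C.Dom × 𝒰) : liftB ρ EB g v p = EB g (ρ p.2) p.1 := rfl

/-- [folklore] The lift of run A, evaluated. -/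
@[simp] theorem liftA_apply (ρ : 𝒰 → C.BgB) (EA : Functional C C.BgA) (g : ℕ → ℝ) (v : (paramCarriers C 𝒰).BgA)
    (p : C.Dom × 𝒰) : liftA ρ EA g v p = EA g (C.transport (ρ p.2)) p.1 := rfl

/-- [folklore] **THE KERNEL'S RUN-B TABLE OF THE LIFT IS THE UNCURRIED FUNCTION TABLE** (by `rfl`) — background-FREE: it does not
read the model's (trivial) background slot. -/
theorem tableB_liftB (ρ : 𝒰 → C.BgB) (EB : Functional C C.BgB) (g : ℕ → ℝ) (v : (paramCarriers C 𝒰).BgB) :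
    tableB (liftB ρ EB) g v = uncurry (funTableB ρ EB g) := rfl

/-- [folklore] The same for run A (at transported backgrounds). -/
theorem tableA_liftA (ρ : 𝒰 → C.BgB) (EA : Functional C C.BgA) (g : ℕ → ℝ) (v : (paramCarriers C 𝒰).BgB) :
    tableA (liftA ρ EA) g v = uncurry (funTableA ρ EA g) := rfl

/-- [folklore] The run-B table of the lift, entrywise. -/
@[simp] theorem tableB_liftB_apply (ρ : 𝒰 → C.BgB) (EB : Functional C C.BgB) (g : ℕ → ℝ) (v : (paramCarriers C 𝒰).BgB)
    (p : C.Dom × 𝒰) : tableB (liftB ρ EB) g v p = EB g (ρ p.2) p.1 := rfl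

/-- [folklore] The run-A table of the lift, entrywise. -/
@[simp] theorem tableA_liftA_apply (ρ : 𝒰 → C.BgB) (EA : Functional C C.BgA) (g : ℕ → ℝ) (v : (paramCarriers C 𝒰).BgB)
    (p : C.Dom × 𝒰) : tableA (liftA ρ EA) g v p = EA g (C.transport (ρ p.2)) p.1 := rfl

/-! ## §3 Transfer of the functional-level hypothesis shapes between `C` and `paramCarriers C 𝒰` -/

section Transfer

variable {ρ : 𝒰 → C.BgB} {EA : Functional C C.BgA} {EB : Functional C C.BgB} {W : Set (ℕ → ℝ)}

/-- [folklore] NE5 over `C` gives NE5 of the lifts (unconditionally). -/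
theorem ne5_lift_of_ne5 (ρ : 𝒰 → C.BgB) {κ θ C₅ : ℝ} (h : NE5 EA EB W κ θ C₅) :
    NE5 (liftA ρ EA) (liftB ρ EB) W κ θ C₅ :=
  fun g hg _ p => h g hg (ρ p.2) p.1

/-- [folklore] **THE END DIRECTION**: NE5 of the lifts over `paramCarriers C 𝒰` gives NE5 over the ORIGINAL carriers, for a
chart ONTO the run-B backgrounds. -/
theorem ne5_of_ne5_lift (hρ : Surjective ρ) {κ θ C₅ : ℝ} (h : NE5 (liftA ρ EA) (liftB ρ EB) W κ θ C₅) :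
    NE5 EA EB W κ θ C₅ := by
  intro g hg U X
  obtain ⟨u, rfl⟩ := hρ U
  exact h g hg PUnit.unit (X, u)

/-- [folklore] NE5 is INVARIANT under the re-indexing along a chart onto the run-B backgrounds. -/
theorem ne5_lift_iff (hρ : Surjective ρ) {κ θ C₅ : ℝ} :
    NE5 (liftA ρ EA) (liftB ρ EB) W κ θ C₅ ↔ NE5 EA EB W κ θ C₅ :=
  ⟨ne5_of_ne5_lift hρ, ne5_lift_of_ne5 ρ⟩

/-- [folklore] Run B's one-run decay bound (L06 shape) transfers to the lift (unconditionally). -/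
theorem decayBound_liftB_of (ρ : 𝒰 → C.BgB) {E₀ κ : ℝ} (h : DecayBound EB W E₀ κ) :
    DecayBound (liftB ρ EB) W E₀ κ :=
  fun g hg _ p => h g hg (ρ p.2) p.1

/-- [folklore] … and back, for a chart onto the run-B backgrounds. -/
theorem decayBound_of_liftB (hρ : Surjective ρ) {E₀ κ : ℝ} (h : DecayBound (liftB ρ EB) W E₀ κ) :
    DecayBound EB W E₀ κ := by
  intro g hg U X
  obtain ⟨u, rfl⟩ := hρ U
  exact h g hg PUnit.unit (X, u)

/-- [folklore] Run B's decay bound is invariant under the re-indexing along a chart onto the run-B backgrounds. -/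
theorem decayBound_liftB_iff (hρ : Surjective ρ) {E₀ κ : ℝ} :
    DecayBound (liftB ρ EB) W E₀ κ ↔ DecayBound EB W E₀ κ :=
  ⟨decayBound_of_liftB hρ, decayBound_liftB_of ρ⟩

/-- [folklore] Run A's one-run decay bound (L05 shape) gives that of the lift (unconditionally). -/
theorem decayBound_liftA_of (ρ : 𝒰 → C.BgB) {E₀ κ : ℝ} (h : DecayBound EA W E₀ κ) :
    DecayBound (liftA ρ EA) W E₀ κ :=
  fun g hg _ p => h g hg (C.transport (ρ p.2)) p.1

/-- [folklore] The decay bound of run A's lift IS run A's decay bound AT TRANSPORTED CHART BACKGROUNDS (all the kernel reads). -/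
theorem decayBound_liftA_iff (ρ : 𝒰 → C.BgB) {E₀ κ : ℝ} :
    DecayBound (liftA ρ EA) W E₀ κ ↔
      ∀ g ∈ W, ∀ (u : 𝒰) (X : C.Dom), |EA g (C.transport (ρ u)) X| ≤ E₀ * Real.exp (-(κ * C.d X)) :=
  ⟨fun h g hg u X => h g hg PUnit.unit (X, u), fun h g hg _ p => h g hg p.2 p.1⟩

/-- [folklore] NE9 of run B transfers to the lift (unconditionally). -/
theorem ne9_liftB_of (ρ : 𝒰 → C.BgB) {κ : ℝ} {Λ : ℕ → ℕ → ℝ} (h : NE9 EB W κ Λ) : NE9 (liftB ρ EB) W κ Λ :=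
  fun g hg g' hg' _ p => h g hg g' hg' (ρ p.2) p.1

/-- [folklore] … and back, for a chart onto the run-B backgrounds. -/
theorem ne9_of_liftB (hρ : Surjective ρ) {κ : ℝ} {Λ : ℕ → ℕ → ℝ} (h : NE9 (liftB ρ EB) W κ Λ) : NE9 EB W κ Λ := by
  intro g hg g' hg' U X
  obtain ⟨u, rfl⟩ := hρ U
  exact h g hg g' hg' PUnit.unit (X, u)

/-- [folklore] NE9 of run B is invariant under the re-indexing along a chart onto the run-B backgrounds. -/
theorem ne9_liftB_iff (hρ : Surjective ρ) {κ : ℝ} {Λ : ℕ → ℕ → ℝ} : NE9 (liftB ρ EB) W κ Λ ↔ NE9 EB W κ Λ :=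
  ⟨ne9_of_liftB hρ, ne9_liftB_of ρ⟩

/-- [folklore] **NE5 OVER `C` FROM NE5 OF ANY PAIR OVER THE RE-INDEXED CARRIERS THAT READS THE TWO RUNS ALONG A SECTION**
`σ : C.BgB → 𝒰` of the chart (owner R49 (4): the complex chart's two real rows, read at the real section's Re-row; `liftA`∕`liftB`
with `ρ ∘ σ = id` is the special case `ne5_of_ne5_lift`). -/
theorem ne5_of_section {E'A : Functional (paramCarriers C 𝒰) (paramCarriers C 𝒰).BgA}
    {E'B : Functional (paramCarriers C 𝒰) (paramCarriers C 𝒰).BgB} (σ : C.BgB → 𝒰)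
    (hA : ∀ g ∈ W, ∀ (U : C.BgB) (X : C.Dom), EA g (C.transport U) X = E'A g PUnit.unit (X, σ U))
    (hB : ∀ g ∈ W, ∀ (U : C.BgB) (X : C.Dom), EB g U X = E'B g PUnit.unit (X, σ U)) {κ θ C₅ : ℝ}
    (h : NE5 E'A E'B W κ θ C₅) : NE5 EA EB W κ θ C₅ := by
  intro g hg U X
  rw [hA g hg U X, hB g hg U X]
  exact h g hg PUnit.unit (X, σ U)

/-- [folklore] Over the re-indexed carriers the background-Lipschitz shape of run A's lift is VACUOUS (gauge `0`): node U3's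
Lipschitz bracket is consumed over the ORIGINAL carriers (`T4OutputRate.u3_threeBrackets`), never over `paramCarriers`. -/
theorem lipBackground_liftA (ρ : 𝒰 → C.BgB) (κ : ℝ) (CU : (ℕ → ℝ) → ℕ → ℝ) :
    LipBackground (liftA ρ EA) W κ CU := by
  intro g _ a b p
  show |liftA ρ EA g a p - liftA ρ EA g b p| ≤ CU g (C.scale p.1) * Real.exp (-(κ * C.d p.1)) * 0
  simp [liftA]

end Transfer

/-! ## §4 A step model over the re-indexed carriers READS FUNCTION TABLES (leaf MI-R instantiable in type) -/

section Model

variable {Op Hist : Type*} [NormedAddCommGroup Op] [NormedSpace ℂ Op] [NormedAddCommGroup Hist] [NormedSpace ℂ Hist]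
variable (M : StepModel (paramCarriers C 𝒰) Op Hist)

/-- [folklore] **`RepresentsB` OVER THE RE-INDEXED CARRIERS, DISPLAYED**: the model represents run B's lift iff, at every
domain `X` of creation step `k` and every chart point `u`, run B's term at the background `ρ u` is the real part of the
step's output AT `(X, u)`, computed from the step's ONE operator datum and from the insertion of run B's FUNCTION TABLE
`(Y, u′) ↦ EB g (ρ u′) Y` — the earlier terms enter AS FUNCTIONS OF THE BACKGROUND ([II] Lemma 1 (1.33): through
`V′_k(Y, U_{k+1}, B′)`), which the value-table model of record cannot express (owner R48). -/
theorem representsB_lift_iff (ρ : 𝒰 → C.BgB) (EB : Functional C C.BgB) (W : Set (ℕ → ℝ)) :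
    M.RepresentsB (liftB ρ EB) W ↔ ∀ g ∈ W, ∀ (X : C.Dom) (u : 𝒰),
      EB g (ρ u) X = (M.Out (C.scale X) (M.opB g PUnit.unit (C.scale X))
        (M.insB g PUnit.unit (C.scale X) (fun p : C.Dom × 𝒰 => EB g (ρ p.2) p.1)) (X, u)).re :=
  ⟨fun h g hg X u => h g hg PUnit.unit (X, u), fun h g hg _ p => h g hg p.1 p.2⟩

/-- [folklore] The same display for run A (function table at transported chart backgrounds, run A's operator datum). -/
theorem representsA_lift_iff (ρ : 𝒰 → C.BgB) (EA : Functional C C.BgA) (W : Set (ℕ → ℝ)) :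
    M.RepresentsA (liftA ρ EA) W ↔ ∀ g ∈ W, ∀ (X : C.Dom) (u : 𝒰),
      EA g (C.transport (ρ u)) X = (M.Out (C.scale X) (M.opA g PUnit.unit (C.scale X))
        (M.insA g PUnit.unit (C.scale X) (fun p : C.Dom × 𝒰 => EA g (C.transport (ρ p.2)) p.1)) (X, u)).re :=
  ⟨fun h g hg X u => h g hg PUnit.unit (X, u), fun h g hg _ p => h g hg p.1 p.2⟩

/-- [folklore] **THE W3 BINDER OVER THE RE-INDEXED CARRIERS, DISPLAYED** (R48-F's sup-over-the-background currency): the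
kernel's single-scale size bound `InsScaleBoundLevel` of a model over `paramCarriers C 𝒰` quantifies over FUNCTION tables
`t : C.Dom × 𝒰 → ℝ` supported on one scale `j < k`, with the entry bound `|t (Y, u)| ≤ T·e^{−κ d(Y)}` FOR EVERY chart point
`u` — i.e. `‖t Y‖_sup ≤ T·e^{−κ d(Y)}` — and bounds the displacement of the inserted history by `c·ω^{k−1−j}·T` margins. -/
theorem insScaleBoundLevel_param_iff (W : Set (ℕ → ℝ)) (κ c ω : ℝ) :
    M.InsScaleBoundLevel W κ c ω ↔ ∀ k, ∀ g ∈ W, ∀ (t : C.Dom × 𝒰 → ℝ) (j : ℕ) (T : ℝ), j < k → 0 ≤ T →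
      (∀ Y u, C.scale Y ≠ j → t (Y, u) = 0) →
        (∀ Y, C.scale Y = j → ∀ u, |t (Y, u)| ≤ T * Real.exp (-(κ * C.d Y))) →
          ‖M.insA g PUnit.unit k t - M.insA g PUnit.unit k 0‖ ≤ M.rHist k * (c * (ω ^ (k - 1 - j) * T)) := by
  refine forall_congr' fun k => forall₂_congr fun g _ => ⟨fun h t j T hj hT hs hb => ?_, fun h v t j T hj hT hs hb => ?_⟩
  · exact h PUnit.unit t j T hj hT (fun p hp => hs p.1 p.2 hp) fun p hp => hb p.1 hp p.2
  · exact h t j T hj hT (fun Y u hY => hs (Y, u) hY) fun Y hY u => hb (Y, u) hY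

/-- [folklore] Likewise the kernel's damped-Lipschitz binder `InsertionDamped` over `paramCarriers C 𝒰`: the inherited
scale-`j` discrepancy level `D j` bounds the two FUNCTION tables' difference AT EVERY chart point — the kernel's `D_j` is
already a supremum over the background (owner l.15388), so the renewal recursion and its letters are unchanged. -/
theorem insertionDamped_param_iff (W : Set (ℕ → ℝ)) (κ c ω : ℝ) :
    M.InsertionDamped W κ c ω ↔ ∀ k, ∀ g ∈ W, ∀ (t t' : C.Dom × 𝒰 → ℝ) (D : ℕ → ℝ), (∀ j < k, 0 ≤ D j) →
      (∀ Y, C.scale Y < k → ∀ u, |t (Y, u) - t' (Y, u)| ≤ D (C.scale Y) * Real.exp (-(κ * C.d Y))) →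
        ‖M.insA g PUnit.unit k t - M.insA g PUnit.unit k t'‖ ≤ M.rHist k * (c * ∑ j ∈ range k, ω ^ (k - j) * D j) := by
  refine forall_congr' fun k => forall₂_congr fun g _ => ⟨fun h t t' D hD hb => ?_, fun h v t t' D hD hb => ?_⟩
  · exact h PUnit.unit t t' D hD fun p hp => hb p.1 hp p.2
  · exact h t t' D hD fun Y hY u => hb (Y, u) hY

/-! ## §5 Specimen END faces: the kernel over `paramCarriers C 𝒰`, conclusion over the ORIGINAL carriers -/

/-- [folklore] **NE5 OVER `C` FROM A STEP MODEL OVER THE RE-INDEXED CARRIERS** (the kernel's `StepModel.ne5_of_stepModel`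
applied to the lifts, then `ne5_of_ne5_lift`): a step model on `paramCarriers C 𝒰` representing the two runs' lifts — i.e.
READING THEIR FUNCTION TABLES — with the kernel's binders, and the two runs' one-run decay bounds OVER `C`, give
`T4OutputRate.NE5 EA EB W κ θ C₅` with the kernel's constant, for a chart onto the run-B backgrounds.  Nothing re-proved. -/
theorem ne5_of_stepModel_lift {ρ : 𝒰 → C.BgB} (hρ : Surjective ρ) {EA : Functional C C.BgA} {EB : Functional C C.BgB}
    {W : Set (ℕ → ℝ)} {κ G E₀ δ δ' θ c ω : ℝ} (hrA : M.RepresentsA (liftA ρ EA) W) (hrB : M.RepresentsB (liftB ρ EB) W)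
    (hbase : M.InBase (liftB ρ EB) W) (henv : M.OutputEnvelope W κ G) (hdA : DecayBound EA W G κ)
    (hdB : DecayBound EB W E₀ κ) (hE₀ : E₀ ≤ G) (hop : M.OperatorRate W δ θ) (hins : M.InsertionRate W κ E₀ δ' θ)
    (hdamp : M.InsertionDamped W κ c ω) (hG : 0 ≤ G) (hδ : 0 ≤ δ + δ') (hc : 0 ≤ c) (hω : 0 ≤ ω)
    (hsmall : (1 + 4 * G * c) * ω < θ) :
    NE5 EA EB W κ θ (4 * G * (δ + δ') * (θ - ω) / (θ - (1 + 4 * G * c) * ω)) :=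
  ne5_of_ne5_lift hρ (M.ne5_of_stepModel hrA hrB hbase henv (decayBound_liftA_of ρ hdA) (decayBound_liftB_of ρ hdB) hE₀
    hop hins hdamp hG hδ hc hω hsmall)

/-- [folklore] The same in the PRINTED age normalisation with the structural binders (`StepModel.ne5_of_stepModel_affine_nat`
over `paramCarriers C 𝒰`): `InsAffine ∧ SizeDampedNat` of the model, read on function tables. -/
theorem ne5_of_stepModel_affine_nat_lift {ρ : 𝒰 → C.BgB} (hρ : Surjective ρ) {EA : Functional C C.BgA}
    {EB : Functional C C.BgB} {W : Set (ℕ → ℝ)} {κ G E₀ δ δ' θ c ω : ℝ} (hrA : M.RepresentsA (liftA ρ EA) W)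
    (hrB : M.RepresentsB (liftB ρ EB) W) (hbase : M.InBase (liftB ρ EB) W) (henv : M.OutputEnvelope W κ G)
    (hdA : DecayBound EA W G κ) (hdB : DecayBound EB W E₀ κ) (hE₀ : E₀ ≤ G) (hop : M.OperatorRate W δ θ)
    (hins : M.InsertionRate W κ E₀ δ' θ) (haff : M.InsAffine W) (hsize : M.SizeDampedNat W κ c ω) (hG : 0 ≤ G)
    (hδ : 0 ≤ δ + δ') (hc : 0 ≤ c) (hω : 0 < ω) (hsmall : ω + 4 * G * c < θ) :
    NE5 EA EB W κ θ (4 * G * (δ + δ') * (θ - ω) / (θ - (ω + 4 * G * c))) :=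
  ne5_of_ne5_lift hρ (M.ne5_of_stepModel_affine_nat hrA hrB hbase henv (decayBound_liftA_of ρ hdA)
    (decayBound_liftB_of ρ hdB) hE₀ hop hins haff hsize hG hδ hc hω hsmall)

end Model

/-! ## §6 Non-vacuity: the kernel's toy re-indexed over `paramCarriers toyCarriers Unit` -/

section Toy

/-- [folklore] The kernel's toy step model RE-INDEXED: every slot read through `toyModel`'s (output at the first component,
tables curried back along `n ↦ (n, ())`, the trivial background slot replaced by the toy's own trivial background). -/
def toyModelParam : StepModel (paramCarriers toyCarriers Unit) ℂ ℂ where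
  Out k o h p := toyModel.Out k o h p.1
  opA g _ k := toyModel.opA g () k
  opB g _ k := toyModel.opB g () k
  insA g _ k t := toyModel.insA g () k fun n => t (n, ())
  insB g _ k t := toyModel.insB g () k fun n => t (n, ())
  Base k g _ := toyModel.Base k g ()
  rOp := toyModel.rOp
  rHist := toyModel.rHist
  rOp_pos := toyModel.rOp_pos
  rHist_pos := toyModel.rHist_pos

/-- [folklore] Toy: run B's lift is represented (the kernel's `toy_representsB`, definitionally). -/
theorem toyParam_representsB : toyModelParam.RepresentsB (liftB id toyEB) Set.univ :=
  fun g hg _ p => toy_representsB g hg p.2 p.1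

/-- [folklore] Toy: run A's lift is represented (the kernel's `toy_representsA`, definitionally). -/
theorem toyParam_representsA : toyModelParam.RepresentsA (liftA id toyEA₂) Set.univ :=
  fun g hg _ p => toy_representsA g hg p.2 p.1

/-- [folklore] Toy: run B's data lie in the base class. -/
theorem toyParam_inBase : toyModelParam.InBase (liftB id toyEB) Set.univ :=
  fun k g hg _ => toy_inBase k g hg ()

/-- [folklore] Toy: the output envelope (entire, bounded by `3` on the unit box). -/
theorem toyParam_outputEnvelope : toyModelParam.OutputEnvelope Set.univ 0 3 :=
  fun k g hg _ p hp X hX => toy_outputEnvelope k g hg () p hp X.1 hX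

/-- [folklore] Toy: the operator rate `(1/2)^k`. -/
theorem toyParam_operatorRate : toyModelParam.OperatorRate Set.univ 1 (1 / 2) :=
  fun k g hg _ => toy_operatorRate k g hg ()

/-- [folklore] Toy: the two runs insert identically. -/
theorem toyParam_insertionRate : toyModelParam.InsertionRate Set.univ 0 3 0 (1 / 2) :=
  fun k g hg _ t ht => toy_insertionRate k g hg () (fun n => t (n, ())) fun n => ht (n, ())

/-- [folklore] Toy: the damped-Lipschitz binder, read on function tables over the one-point chart. -/
theorem toyParam_insertionDamped : toyModelParam.InsertionDamped Set.univ 0 1 (1 / 64) :=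
  fun k g hg _ t t' D hD ht => toy_insertionDamped k g hg () (fun n => t (n, ())) (fun n => t' (n, ())) D hD
    fun n hn => ht (n, ()) hn

/-- [folklore] **The re-indexed road is inhabited and the kernel's END fires on it**: NE5 for the LIFTS of the kernel's toy
pair over `paramCarriers toyCarriers Unit` (the kernel's `StepModel.ne5_of_stepModel` applied to `toyModelParam`; the one-run
decay bounds enter through `decayBound_liftA_of` ∕ `decayBound_liftB_of`), constant `372/19` as in the kernel's `toy_ne5Data`. -/
theorem toyParam_ne5 : NE5 (liftA id toyEA₂) (liftB id toyEB) (Set.univ : Set (ℕ → ℝ)) 0 (1 / 2)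
    (4 * 3 * (1 + 0) * (1 / 2 - 1 / 64) / (1 / 2 - (1 + 4 * 3 * 1) * (1 / 64))) :=
  toyModelParam.ne5_of_stepModel toyParam_representsA toyParam_representsB toyParam_inBase toyParam_outputEnvelope
    (decayBound_liftA_of id toy_decayA) (decayBound_liftB_of id toy_decayB) le_rfl toyParam_operatorRate
    toyParam_insertionRate toyParam_insertionDamped (by norm_num) (by norm_num) (by norm_num) (by norm_num) (by norm_num)

/-- [folklore] … and the transfer `ne5_of_ne5_lift` (identity chart, onto) returns NE5 OVER THE ORIGINAL toy carriers — the
statement of the kernel's landed `toy_ne5Data`, here RECOVERED THROUGH THE LIFT (an `example`: the statement is the kernel's,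
not restated as a declaration); equally `ne5_of_stepModel_lift toyModelParam surjective_id …` in one step. -/
example : NE5 toyEA₂ toyEB (Set.univ : Set (ℕ → ℝ)) 0 (1 / 2)
    (4 * 3 * (1 + 0) * (1 / 2 - 1 / 64) / (1 / 2 - (1 + 4 * 3 * 1) * (1 / 64))) :=
  ne5_of_ne5_lift surjective_id toyParam_ne5

end Toy

end Summit.QuantumFields.BalabanUV.T4Continuum.OutputRateFunctionalTables

end
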